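/-
Copyright (c) 2026 the pub-hodgecm-mathlib formalisation cell (harness21).  Prover seat hodgecm-mathlib-K2E1-p13 (g3), Track B ∕ K2-LIT, h413 = `stmt-HodgeConjecture-24833`,
line `K2_E1_TraceFormulaBeta`, route of record `HCCMUnconditional`; dealer K2E1-plan (g7) (258) «TAKE σ2»: the scalar functional equation at M1 — ★ C3 FILE 2
`chi_scattering_fe_cm_two` (this lineage, g2) INSTANTIATED on the `n = 0` ball package of ★ X1_χ §2c (K2E1-p14 g0) over the M1 ball data ★ `exists_convData_maximalLevel_cm_two`.
-/
import Summits.HodgeConjecture.HodgeConjecture.Theorems.K2E1ChiScatteringFunctionalEquationCMTwoGlobal   -- ★ p860120 C3 FILE 2 (this lineage, g2): `chi_scattering_fe_cm_two`; brings ★ X1_χ §2c `exists_chi_ball_package_cm_two_of_letters'`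
import Summits.HodgeConjecture.HodgeConjecture.Theorems.K2E1ChiConvDataMaximalLevelCMTwo                  -- ★ (K2E1-p14 g0): the M1 ball data `exists_convData_maximalLevel_cm_two`
import HarnessLib

/-!
# K2·E1 — `K2E1ChiScatteringFunctionalEquationM1CMTwo`: THE SCALAR FUNCTIONAL EQUATION `s(z)·s(1 − z) = 1` OF THE M1 SCATTERING SCALAR `s = qc default` OF A SELF-DUAL `χ` OF
# `U(1,1)_{L∕L⁺}` — the σ2 socket of ★ `chi_scattering_real_poles_m1_letterFree_cm_two` ∕ the `hFE` letter of ★ p860080 ∕ ★ p860392, hypothesis-first on the package clauses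

Track B ∕ K2-LIT, crux h413 = `stmt-HodgeConjecture-24833`; cell `hodgecm-mathlib`, squad K2, ENGINE E1, campaign «5Res», (SD) road at M1 (consumers: K2E1-p14 (g2)'s (SD) M1 final assembly
and this seat's ★ `K2E1ChiScatteringRealPolesM1CMTwoLetterFree`).  THEOREMS ONLY (no `def`, no `instance`, no notation, no named-fact hypothesis, no `sorry`; default heartbeats); lane
`--kind proof --supports stmt-HodgeConjecture-24833 --as helper` (count-neutral).  Closes no socket.

THE MATHEMATICS ([BernsteinLapid2019, §4 Claims 2–5, §5]; [MoeglinWaldspurger1995, IV.1.8–IV.1.10]; [Langlands1976, §7]).  ★ C3 FILE 2 `chi_scattering_fe_cm_two` proves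
`qc(z)·qc′(1 − z) = 1` off `P ∪ (1 − P′)` from: (i) a χ-ball package, (ii) a χʷ-ball package on the same ball, (iii) the swap identities of their constant-term data, (iv) the global
scalars' agreement with the ball coordinates on the tube.  AT M1 FOR A SELF-DUAL `χ` (`χʷ = χ`, rank one: the singleton basis `{φ}` of `V(χʷ, K_max, 1) = V(χ, K_max, 1)`) ONE package
serves both sides: the `n = 0` ball package of ★ X1_χ §2c `exists_chi_ball_package_cm_two_of_letters'` for `(φ, φ′ := {φ}, bX := q)` over the M1 ball data ★
`exists_convData_maximalLevel_cm_two` (its scalar-action clause pays `hS1` under `φ ∘ ι_∞ = φ(1)`); the swap identities (iii) are `Lp.ext` of the package's a.e. clauses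
`α₁(w) =ᵐ zFun f_w^φ`, `col(w) =ᵐ zFun f^φ_{1−w}` at `w = 1 − z` and `w = z`; the agreement (iv) `cc z = q z = qc z` on `U ∩ {1 < Re}` is the package's Godement clause and the letter
`hqcq`.  Hence, for ANY package `(q, qc, P)` with the clause letters `hqφ` (scattering coordinates on the tube), `hqcq`, `hPc hPcd hPre hqa` — in particular THE package of ★ (α) ∕ ★
K2E4-p14's `exists_scattering_scalar_package_selfDual_m1_cm_two` — **`∀ z, z ∉ P → 1 − z ∉ P → qc default z · qc default (1 − z) = 1`**.
* §1 `swap_of_ae` (two `𝓗_k(Z_a)`-classes with the same a.e. representative are equal — `Lp.ext`).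
* §2 HEAD **`chi_scattering_fe_m1_cm_two`**.
HONEST LABEL: HC_CM is proved only modulo the 7 printed citations (2 remaining named inputs: hLiu418 = `stmt-HodgeConjecture-24832`, h413 = `stmt-HodgeConjecture-24833`) until rung 0
closes; this file asserts no named fact, is hypothesis-first on the package clauses, and closes no socket.

## References
* [BernsteinLapid2019] J. Bernstein, E. Lapid, *On the meromorphic continuation of Eisenstein series*, J. AMS 37 (2024), §4 Claims 2–5, §5.
* [MoeglinWaldspurger1995] C. Mœglin, J.-L. Waldspurger, *Spectral decomposition and Eisenstein series* (1995), IV.1.8–IV.1.10.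
* [Langlands1976] R. P. Langlands, *On the Functional Equations Satisfied by Eisenstein Series*, LNM 544 (1976), §7.
-/

set_option autoImplicit false
set_option linter.dupNamespace false  -- the mandated namespace repeats the summit's segment (`HodgeConjecture.HodgeConjecture`)

noncomputable section

open MeasureTheory Measure Filter Topology Set NumberField IsDedekindDomain
open scoped NNReal ENNReal ComplexConjugate
open Literature.MeasureTheory.Group Literature.NumberTheory Literature.NumberTheory.Automorphic Literature.NumberTheory.Automorphic.UnitaryGroup AdelicGroupData
open Literature.NumberTheory.GaloisRepresentations (HeckeCharacter)
open Summit.HodgeConjecture.HodgeConjecture.Cruxes.H413.K2E1BorelEisensteinU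
open Summit.HodgeConjecture.HodgeConjecture.Cruxes.H413.K2E1BLBorelSpacesU2Defs
open Summit.HodgeConjecture.HodgeConjecture.Cruxes.H413.K2E1BLBorelOperatorsU2Defs
open Summit.HodgeConjecture.HodgeConjecture.Cruxes.H413.K2E1CharacterEisensteinU2Defs
open Summit.HodgeConjecture.HodgeConjecture.Cruxes.H413.K2E1ChiSectionSpaceU2Defs
open Summit.HodgeConjecture.HodgeConjecture.Cruxes.H413.K2E1ChiEisensteinBallPackageCMTwoScalar (exists_chi_ball_package_cm_two_of_letters')
open Summit.HodgeConjecture.HodgeConjecture.Cruxes.H413.K2E1ChiConvDataMaximalLevelCMTwo (exists_convData_maximalLevel_cm_two)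
open Summit.HodgeConjecture.HodgeConjecture.Cruxes.H413.K2E1ChiScatteringFunctionalEquationCMTwoGlobal (chi_scattering_fe_cm_two)

namespace Summit.HodgeConjecture.HodgeConjecture.Cruxes.H413.K2E1ChiScatteringFunctionalEquationM1CMTwo

/-! ## §1 Two `L²`-classes with a common a.e. representative coincide -/

/-- `u =ᵐ f` and `v =ᵐ f` ⟹ `u = v` in `Lp` (`Lp.ext`) — the swap identities of the constant-term data are instances. [folklore] -/
theorem swap_of_ae {X : Type*} [MeasurableSpace X] {m : Measure X} {u v : Lp ℂ 2 m} {f : X → ℂ}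
    (hu : ((u : Lp ℂ 2 m) : X → ℂ) =ᵐ[m] f) (hv : ((v : Lp ℂ 2 m) : X → ℂ) =ᵐ[m] f) : u = v :=
  Lp.ext (hu.trans hv.symm)

/-! ## §2 HEAD: the scalar functional equation at M1 -/

section Head

variable (L : Type) [Field L] [NumberField L] [IsCMField L]
  [MeasurableSpace (quasiSplit (↥(maximalRealSubfield L)) L (IsCMField.complexConj L) 2).Adelic] [BorelSpace (quasiSplit (↥(maximalRealSubfield L)) L (IsCMField.complexConj L) 2).Adelic]

/-- **THE SCALAR FUNCTIONAL EQUATION `qc(z)·qc(1 − z) = 1` AT M1 FOR A SELF-DUAL `χ`** (module docstring).  Binders: the structural data of ★ X1_χ∕X2_χ at CM (`μ νG ν 𝓕 β μZ`); `χʷ = χ`; the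
M1 section `φ ∈ V(χ, K_max, 1)` continuous bounded with `φ ∘ ι_∞ = φ(1)` and `φ ≠ 0` (so `{φ}` is linearly independent); and ANY package `(q, qc, P)` at the singleton index with the clause
letters `hqφ` (`Σ_j q_j(z)·φ = (ν𝓕)⁻¹·φ̃_z·H^{z−1}` on the tube), `hqcq` (`qc_j = q_j` on the tube), `hPc hPcd hPre hqa` (★ (α) ∕ ★ K2E4-p14 §3 shapes).  THEN
`∀ z, z ∉ P → 1 − z ∉ P → qc default z * qc default (1 − z) = 1` — ★ `chi_scattering_fe_cm_two` on the `n = 0` ball package of ★ §2c over ★ `exists_convData_maximalLevel_cm_two`, ONE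
package on both sides, swap identities by `Lp.ext`, agreement by the Godement clause + `hqcq`. [cite: BernsteinLapid2019, §4 Claims 2–5 and §5] [cite: MoeglinWaldspurger1995, IV.1.8–IV.1.10]
[cite: Langlands1976, §7] -/
theorem chi_scattering_fe_m1_cm_two
    (μ : Measure (quasiSplit (↥(maximalRealSubfield L)) L (IsCMField.complexConj L) 2).automorphicQuotient) [(quasiSplit (↥(maximalRealSubfield L)) L (IsCMField.complexConj L) 2).IsAutomorphicMeasure μ]
    (νG : Measure (quasiSplit (↥(maximalRealSubfield L)) L (IsCMField.complexConj L) 2).Adelic) [νG.IsHaarMeasure] [νG.IsInvInvariant] [SFinite νG]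
    (ν : Measure ↥(adelicUnipotent (↥(maximalRealSubfield L)) L (IsCMField.complexConj L) 2)) [ν.IsHaarMeasure] [ν.IsMulRightInvariant] [ν.IsInvInvariant]
    {𝓕 : Set ↥(adelicUnipotent (↥(maximalRealSubfield L)) L (IsCMField.complexConj L) 2)}
    (h𝓕N : IsFundamentalDomain ↥(rationalUnipotent (↥(maximalRealSubfield L)) L (IsCMField.complexConj L) 2) 𝓕 ν) (h𝓕c : IsCompact (closure 𝓕)) (h𝓕₀ : ν 𝓕 ≠ 0)
    {β : (quasiSplit (↥(maximalRealSubfield L)) L (IsCMField.complexConj L) 2).Adelic → ℝ≥0∞}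
    (hβ : IsCoveringWeight ↥((arithmeticBorel (↥(maximalRealSubfield L)) L (IsCMField.complexConj L) 2).map (quasiSplit (↥(maximalRealSubfield L)) L (IsCMField.complexConj L) 2).arithmeticSubgroup.subtype) β)
    {μZ : Measure (borelQuotient (↥(maximalRealSubfield L)) L (IsCMField.complexConj L) 2)} [SFinite μZ]
    (hμZ : ∀ f : borelQuotient (↥(maximalRealSubfield L)) L (IsCMField.complexConj L) 2 → ℝ≥0∞, Measurable f → ∫⁻ z, f z ∂μZ = ∫⁻ g, β g * f (toBorelQuotient (↥(maximalRealSubfield L)) L (IsCMField.complexConj L) 2 g) ∂νG)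
    -- the self-dual character and the M1 section
    {χ : HeckeCharacter L} (hsd : reflectChar (IsCMField.complexConj L) χ = χ)
    {φ : (quasiSplit (↥(maximalRealSubfield L)) L (IsCMField.complexConj L) 2).Adelic → ℂ} (hφV : φ ∈ chiSectionSpace χ ((standardMaximalCompactGL 2 L).comap (adelicVal (↥(maximalRealSubfield L)) L (IsCMField.complexConj L) 2 ((StdForm.antidiagonal 2).over L)) : Subgroup (quasiSplit (↥(maximalRealSubfield L)) L (IsCMField.complexConj L) 2).Adelic) (fun _ => 1)) (hφc : Continuous φ) {Mφ : ℝ} (hφM : ∀ x, ‖φ x‖ ≤ Mφ)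
    (hφinf : ∀ a : arch (↥(maximalRealSubfield L)) L (IsCMField.complexConj L) 2 ((StdForm.antidiagonal 2).over L), φ (archToAdelic (↥(maximalRealSubfield L)) L (IsCMField.complexConj L) 2 _ a) = φ 1)
    (hφ0 : φ ≠ 0)
    -- the package clauses at the singleton index (`b := φ`)
    {q qc : Unit → ℂ → ℂ} {P : Set ℂ}
    (hqφ : ∀ z : ℂ, 1 < z.re → (∑ j, q j z • φ) = ((((ν 𝓕).toReal⁻¹ : ℝ)) : ℂ) • (fun g : (quasiSplit (↥(maximalRealSubfield L)) L (IsCMField.complexConj L) 2).Adelic => (∫ v : ↥(adelicUnipotent (↥(maximalRealSubfield L)) L (IsCMField.complexConj L) 2), flatSectionU φ z ((quasiSplit (↥(maximalRealSubfield L)) L (IsCMField.complexConj L) 2).toAdelic (weylLongU ((IsCMField.complexConj L : L ≃ₐ[↥(maximalRealSubfield L)] L) : L →+* L) (rfl : (StdForm.antidiagonal 2).over L = (StdForm.antidiagonal 2).over L)) * ((v : (quasiSplit (↥(maximalRealSubfield L)) L (IsCMField.complexConj L) 2).Adelic) * g)) ∂ν) * (((borelHeight g : ℝ) : ℂ) ^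 (z - 1))))
    (hqcq : ∀ j (z : ℂ), 1 < z.re → qc j z = q j z)
    (hPc : IsClosed P) (hPcd : ∀ z₀ : ℂ, ∀ᶠ s in 𝓝[≠] z₀, s ∉ P) (hPre : ∀ z ∈ P, z.re ≤ 1) (hqa : ∀ j (z : ℂ), z ∉ P → AnalyticAt ℂ (qc j) z) :
    ∀ z : ℂ, z ∉ P → 1 - z ∉ P → qc default z * qc default (1 - z) = 1 := by
  classical
  -- the M1 ball data on the ball `n = 0`
  obtain ⟨a, ha, I, hIf, i₀, η, κ, T, hη, hconv, h1, hcov, -, hκ, hcmp, hι, -, hT, hpack, -, hS1M⟩ := exists_convData_maximalLevel_cm_two L μ νG hβ hμZ 0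
  -- the self-dual singleton family `{φ}` in `V(χʷ, K_max, 1)`
  have hli : LinearIndependent ℂ (fun _ : Unit => φ) := linearIndependent_unique_iff.2 hφ0
  have hφ'χ : ∀ _j : Unit, IsChiSection (reflectChar (IsCMField.complexConj L) χ) ((fun _ : Unit => φ) _j) := fun _ => by
    rw [hsd]
    exact isChiSection_of_mem hφV
  -- ★ X1_χ §2c: the `n = 0` ball package for `(φ, {φ}, q)`
  obtain ⟨U, vX, cc, hb, α₁, col, hUo, hUD, -, hUcd, -, -, hccd, -, hα₁ae, hcolae, heqs, hunq, hgod, -⟩ :=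
    exists_chi_ball_package_cm_two_of_letters' L μ νG ν h𝓕N h𝓕c h𝓕₀ hβ hμZ 0 i₀ η ha κ T (fun i => (hη i).1)
      (fun i => ⟨(hconv i).1, (hconv i).2.1, (hconv i).2.2.2.1, (hconv i).2.2.2.2.1, (hconv i).2.2.2.2.2⟩) h1 hcov hκ hcmp hι hT hpack hφV hφc hφM hli (fun _ => hφc) hφ'χ
      (Mb := Mφ) (fun _ x => hφM x) (fun z j => q j z) (fun z _ hz1 => hqφ z hz1) (fun i z _ x => hS1M i χ φ hφV hφinf z x)
  -- (iii) the swap identities: both sides are a.e. `zFun f^φ_{1−z}`, resp. `zFun f^φ_z`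
  have hsw₁ : ∀ z ∈ U, 1 - z ∈ U → α₁ (1 - z) = col default z := fun z hz h1z =>
    swap_of_ae (hα₁ae (1 - z) (hUD h1z)) (hcolae default z (hUD hz))
  have hsw₂ : ∀ z ∈ U, 1 - z ∈ U → ∀ k : Unit, col k (1 - z) = α₁ z := fun z hz h1z k => by
    obtain rfl : k = default := Subsingleton.elim _ _
    have h := hcolae default (1 - z) (hUD h1z)
    rw [sub_sub_cancel] at h
    exact swap_of_ae h (hα₁ae z (hUD hz))
  -- (iv) the agreement `cc z default = qc default z` on `U ∩ {1 < Re}` (Godement clause + `hqcq`)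
  have hagree : ∀ z ∈ U, 1 < z.re → cc z default = qc default z := fun z hz hz1 => by
    rw [(hgod z hz hz1).2, hqcq default z hz1]
  -- ★ C3 FILE 2 with ONE package on both sides
  exact chi_scattering_fe_cm_two L νG hb
    (h := fun (i : I) (y : (quasiSplit (↥(maximalRealSubfield L)) L (IsCMField.complexConj L) 2).Adelic) => orbitalSmoothing νG (fun x : (quasiSplit (↥(maximalRealSubfield L)) L (IsCMField.complexConj L) 2).Adelic => ((η i (adelicVal (↥(maximalRealSubfield L)) L (IsCMField.complexConj L) 2 ((StdForm.antidiagonal 2).over L) x) : ℝ) : ℂ)) (fun x : (quasiSplit (↥(maximalRealSubfield L)) L (IsCMField.complexConj L) 2).Adelic => ((η i (adelicVal (↥(maximalRealSubfield L)) L (IsCMField.complexConj L) 2 ((StdForm.antidiagonal 2).over L) x) : ℝ) : ℂ)) y)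
    (fun i k₁ hk₁ x => (hconv i).2.2.1 k₁ hk₁ x) (fun i => (hconv i).1) (fun i => (hconv i).2.1) T default hUo hUD hUcd hccd heqs hunq
    hUo hUD hUcd hccd heqs hsw₁ hsw₂ hPc hPcd hPre (hqa default) hPc hPcd hPre (hqa default) hagree hagree

end Head

end Summit.HodgeConjecture.HodgeConjecture.Cruxes.H413.K2E1ChiScatteringFunctionalEquationM1CMTwo

end
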